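import Mathlib
import Literature.NumberTheory.Transcendental.ZagierDilogarithmConjecture
import Literature.NumberTheory.Transcendental.BlochWignerDilogarithm
import Literature.NumberTheory.Transcendental.BlochWignerDilogarithmProofs
import Summits.KontsevichZagierPeriods.KontsevichZagierPeriods.Theorems.HyperbolicBlochZagierDilogarithmConjectureStubCyclotomicSectorTorsionIff
import Summits.KontsevichZagierPeriods.KontsevichZagierPeriods.Theorems.HyperbolicBlochZagierDilogarithmConjectureStubCyclotomicFolding
import Summits.KontsevichZagierPeriods.KontsevichZagierPeriods.Theorems.HyperbolicBlochZagierDilogarithmConjectureStubCyclotomicSpanning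
import HarnessLib

/-!
# `ZagierDilogarithmConjecture` (stmt-KontsevichZagierPeriods-10550) — line `kummer-clausen-linearisation`
(reshape c5, "the cyclotomic tower and the abelian sector"), stub `stub_cyclotomicSector_iff_milnor`

**The full level-`N` cyclotomic sector of Zagier's conjecture (torsion form) is equivalent to Milnor's
conjecture for `N`, for EVERY `N` (composite included), unconditionally.** Let `ζ_N = e^{2πi/N}`, `D`
the Bloch–Wigner dilogarithm (`blochWignerDilog`) and `⟨dilogRelators⟩ ⊆ ℤ[ℂ]` the relator group of
Zagier's dilogarithm conjecture (Neumann 1998, §2.1). The following are equivalent, for every `N ≥ 1`: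

* (the level-`N` cyclotomic sector, torsion form) every `ℤ`-relation `Σᵢ nᵢ D(uᵢ) = 0` among `N`-th
  roots of unity `uᵢ` of the open upper half plane (imprimitive ones allowed) has a positive multiple of
  its formal combination explained: `M · Σᵢ nᵢ [uᵢ] ∈ ⟨dilogRelators⟩` for some `M ≥ 1`;
* (Milnor's conjecture for `N`, `ℤ`-form) the Clausen values `D(ζ_N^c)`, `(c, N) = 1`, `0 < c < N/2`,
  admit only the trivial `ℤ`-relation (Milnor 1982, Appendix).

This is the unconditional form of `stub_cyclotomicSectorTorsion_iff`, whose folding hypothesis is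
discharged here; the neighbouring stub `stub_allRootsOfUnity_iff_milnor` assembles all levels.

Proof. A pure composition of three landed theorems of this line:
`stub_cyclotomicSectorTorsion_iff : FOLDING → ∀ N, (sector_N ↔ Milnor_N)`,
`stub_cyclotomicFolding : SPANNING → FOLDING` (every class `[ζ_N^c]` has a positive multiple congruent
modulo `⟨dilogRelators⟩` to a combination supported on the units of the open upper half) and
`stub_cyclotomicSpanning : SPANNING` (the weight-2 Kubert spanning: every `[ζ_N^c]` has a positive
multiple congruent to a combination supported on the primitive `N`-th roots of unity).
Sorry-free; axioms ⊆ {propext, Classical.choice, Quot.sound}.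

## References

* W. D. Neumann, *Hilbert's 3rd problem and invariants of 3-manifolds*, Geom. Topol. Monogr. 1 (1998),
  §2.1. [Neumann1998]
* J. Milnor, *Hyperbolic geometry: the first 150 years*, Bull. AMS 6 (1982), Appendix (the conjecture
  on the values `Л(πc/N)`). [Milnor1982]
-/

noncomputable section

open scoped BigOperators ComplexConjugate
open Literature.NumberTheory.Transcendental

namespace Summit.KontsevichZagierPeriods.HyperbolicBloch.ZagierDilogarithmCyclotomic

/-- **Stub `stub_cyclotomicSector_iff_milnor`: the full level-`N` cyclotomic sector of Zagier's
conjecture (torsion form) is equivalent to Milnor's conjecture for `N`, for EVERY `N` (composite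
included), unconditionally.** Zagier's conjecture restricted to `N`-th roots of unity of `ℍ⁺` in
torsion form (every `ℤ`-relation among their `D`-values has a positive multiple of its formal
combination in `⟨dilogRelators⟩`) holds if and only if the Clausen values `D(ζ_N^c)`, `(c, N) = 1`,
`0 < c < N/2`, are `ℤ`-linearly independent. Composition of `stub_cyclotomicSectorTorsion_iff` (the
equivalence under folding) with `stub_cyclotomicFolding` (spanning gives folding) and
`stub_cyclotomicSpanning` (the Kubert spanning by primitive roots). [cite: Milnor1982, Appendix] -/
theorem stub_cyclotomicSector_iff_milnor :
    ∀ (N : ℕ) [NeZero N],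
      (∀ (k : ℕ) (u : Fin k → ℂ) (n : Fin k → ℤ), (∀ i, u i ^ N = 1) → (∀ i, 0 < (u i).im) →
          ∑ i, (n i : ℝ) * blochWignerDilog (u i) = 0 →
            ∃ M : ℕ, 0 < M ∧ M • (∑ i, n i • FreeAbelianGroup.of (u i)) ∈ AddSubgroup.closure dilogRelators) ↔
        (∀ m : ZMod N → ℤ, (∀ c, m c ≠ 0 → IsUnit c ∧ 0 < c.val ∧ 2 * c.val < N) →
          ∑ c : ZMod N, (m c : ℝ) *
              blochWignerDilog (Complex.exp (2 * Real.pi * Complex.I / N) ^ c.val) = 0 →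
            ∀ c, m c = 0) := by
  intro N _
  exact stub_cyclotomicSectorTorsion_iff (stub_cyclotomicFolding stub_cyclotomicSpanning) N

end Summit.KontsevichZagierPeriods.HyperbolicBloch.ZagierDilogarithmCyclotomic

end
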